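import Literature.MathematicalPhysics.QuantumLattice.HubbardHubbardModelProofs
import Literature.MathematicalPhysics.QuantumLattice.HubbardHubbardModelPairDecayProofs
import Literature.MathematicalPhysics.QuantumLattice.HubbardHubbardModelKomaTasakiProofs
import HarnessLib

/-!
# Koma–Tasaki: no superconducting or magnetic long-range order in the 2D Hubbard model at `T > 0`

Sibling proof file of `Literature/MathematicalPhysics/QuantumLattice/HubbardHubbardModel.lean`
(trunk T-QLATTICE, family `hubbard`, statement hubbard.S11). It DISCHARGES the named fact
`Literature.MathematicalPhysics.QuantumLattice.koma_tasaki_noLRO` of that file: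

`theorem koma_tasaki_noLRO_holds : koma_tasaki_noLRO` — for any `t, U, μ` and `0 < β`, the
thermal pair and transverse-spin two-point functions of the grand-canonical Hubbard model on
the tori `(ℤ/Lℤ)²` have no long-range order in the outline-§0 sense
(`¬ QLattice.HasTorusLRO`, i.e. not `0 < liminf_L L⁻⁴ Σ_{x,y} G_L(x, y)`).

It is the one-line assembly of three accepted sibling files, following the printed deduction
("The bounds rule out the possibility of the corresponding condensation of superconducting
electron pairs, and of the corresponding magnetic ordering", Koma–Tasaki, abstract and p. 3):

* `HubbardHubbardModelPairDecayProofs` — `koma_tasaki_2d_holds`, the uniform-in-`L` power-law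
  bound `|⟨c†_{x↑} c†_{x↓} c_{y↓} c_{y↑}⟩_{β,L}| ≤ C (dist(x,y) + 1)^{-f(β)}` (Theorem, eq. (2));
* `HubbardHubbardModelKomaTasakiProofs` — `koma_tasaki_magnetic_holds`, the same for
  `⟨S⁺_x S⁻_y⟩_{β,L}` (Theorem, eq. (4)) together with its one-dimensional half;
* `HubbardHubbardModelProofs` — `koma_tasaki_noLRO_of`, the summation lemma: a uniform power
  law `C (dist + 1)^{-f}`, `f > 0`, has `Σ_{x,y ∈ (ℤ/Lℤ)²} |G_L(x,y)| = o(L⁴)`, hence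
  `¬ HasTorusLRO` (`not_hasTorusLRO_of_abs_le_rpow`).

No definition and no statement is introduced or changed here.

## Source

T. Koma, H. Tasaki, *Decay of superconducting and magnetic correlations in one- and
two-dimensional Hubbard models*, PRL **68** (1992) 3248 = arXiv:cond-mat/9709068: Theorem
(p. 2, eqs. (2)–(4)) and the corollary stated in the abstract and on p. 3 ("The above bounds
rigorously rule out the possibility of the corresponding condensations of electrons or electron
pairs and of the corresponding magnetic ordering.").
-/

namespace Literature.MathematicalPhysics.QuantumLattice

/-- **Discharge of `koma_tasaki_noLRO`** (hubbard.S11, corollary): no superconducting and no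
transverse magnetic long-range order (`QLattice.HasTorusLRO`) in the two-dimensional Hubbard
model at any temperature `T = 1/β > 0`, for any hopping `t`, interaction `U` and chemical
potential `μ` — from the uniform power-law bounds `koma_tasaki_2d_holds`,
`koma_tasaki_magnetic_holds` and the reduction `koma_tasaki_noLRO_of`.
Koma–Tasaki, PRL 68 (1992) 3248, Corollary (abstract and p. 3: "The bounds rule out the
possibility of the corresponding condensation of superconducting electron pairs, and of the
corresponding magnetic ordering"). [cite: KomaTasakiPRL1992, Corollary (abstract; p. 3)] -/
theorem koma_tasaki_noLRO_holds : koma_tasaki_noLRO :=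
  koma_tasaki_noLRO_of koma_tasaki_2d_holds koma_tasaki_magnetic_holds

end Literature.MathematicalPhysics.QuantumLattice
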